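import Literature.Analysis.Complex.AnnulusHarmonicSchwarz
import Literature.Analysis.Complex.HarmonicRemovableSingularity
import HarnessLib

/-!
# The planar core of the dipole construction on a parabolic Riemann surface (Lin (7.3.3.3))

Topic `Literature/Analysis/Complex` (PROOF-ONLY: no definition, no named fact; classical, [folklore]).
I-Hsiung Lin, *Classical Complex Analysis: A Geometric Approach*, vol. 2 (World Scientific 2011), §7.3.3,
(7.3.3.3) «Existence of a harmonic function with a singularity on a nonhyperbolic Riemann surface» (held
copy, chunks p0433–p0438): for `R` parabolic, `p₀ ∈ R` and a chart `z` at `p₀`, the bounded harmonic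
functions `u_ρ` on `R − D̄_ρ` with boundary values `Re 1/z` on `|z| = ρ` converge, as `ρ → 0`, to a
harmonic `u` on `R − {p₀}`, bounded off every `D_ρ`, with `u − Re 1/z` harmonic at `p₀` and vanishing
there.  Its proof has a SURFACE part (Perron's method and the maximum principle (7.3.1.8) on `R − D̄_ρ`;
zero flux, Lemma (7.3.3.4)) and a PLANAR part in the chart annulus `ρ ≤ |z| ≤ 1` (Step 1, (*5)–(*12):
the estimate uniform in `ρ`; Step 3: removability at `p₀`).  This file is the planar part, over the
annulus Schwarz bound of `AnnulusHarmonicSchwarz`, in a series-free form, with a general centre `c` and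
outer radius `R`:

* §1 ZERO FLUX AS HOLOMORPHY.  `circleAverage_eq_of_differentiableOn_annulus`,
  `circleAverage_re_eq_of_differentiableOn_annulus` — for `F` holomorphic on the open annulus the circle
  means `⨍_{‖z−c‖=t} F`, `⨍ Re F` do not depend on `t` (Cauchy–Goursat for annuli);
  `circleAverage_eq_circleAverage_of_re_eq`, `circleAverage_eq_zero_of_re_eq` — for `w` continuous on the
  closed annulus with `w = Re F` inside, the means over the two boundary circles agree (continuity of
  `t ↦ ⨍_{‖z−c‖=t} w`, Mathlib's `ContinuousOn.circleAverage`).  Lin obtains the single-valued conjugate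
  `f_ρ = u_ρ + i ∫ *du_ρ` of (*6) from zero flux (7.3.3.4); in general `⨍_{‖z−c‖=t} u = a + b log t` with
  `2πb` the flux, and `b = 0` is exactly the zero-mean hypothesis of the annulus Schwarz bound.
* §2 THE DIPOLE ESTIMATE (*5)/(*12).  `abs_sub_re_inv_le_of_harmonicOnNhd_annulus`: `u` continuous on
  `ρ ≤ ‖z − c‖ ≤ R`, harmonic inside, `u = Re (z − c)⁻¹` on the inner circle, `|u| ≤ M` and zero mean on
  the outer circle ⟹ `|u(z) − Re (z − c)⁻¹| ≤ 4(M + R⁻¹)‖z − c‖/R`;  `abs_sub_re_inv_le_of_re_eq` — the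
  same with the zero mean replaced by `u = Re F` inside.
* §3 THE BOOTSTRAP (Lin's `C(r)`).  `dipole_bootstrap` (`M ≤ r⁻¹ + 4(M + R⁻¹)r/R`, `8r ≤ R` ⟹
  `M ≤ 2r⁻¹ + R⁻¹`) and `abs_sub_re_inv_le_uniform`: if the outer bound `M` is attained by `|u|` on a
  circle `‖z − c‖ = r`, `ρ ≤ r ≤ R/8` (what the maximum principle on `R − D̄_r` gives for
  `M := max_{‖z−c‖=r} |u_ρ|`), then `|u(z) − Re (z − c)⁻¹| ≤ 8(r⁻¹ + R⁻¹)‖z − c‖/R`, free of `ρ` and `M`.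
* §4 REMOVABILITY (Step 3, (2)(b)).  `exists_harmonicOnNhd_eq_sub_re_inv`: `u` harmonic on
  `0 < ‖z − c‖ < R` with `|u − Re (z − c)⁻¹| ≤ C‖z − c‖` ⟹ `u − Re (z − c)⁻¹ = h` there for an `h`
  harmonic on the disc with `h(c) = 0` (the tree's removable singularity theorem for bounded harmonic
  functions, `exists_harmonicOnNhd_ball_eqOn_of_bounded`).

How the surface proof is expected to consume this (for the assembler of (7.3.3.3); nothing of it is
proved here): with §3, for `ρ′ < ρ ≤ r` the difference `u_ρ − u_ρ′` is bounded harmonic on `R − D̄_ρ`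
with boundary values `Re (z − c)⁻¹ − u_ρ′` of size `≤ 8(r⁻¹ + R⁻¹)ρ/R` on `‖z − c‖ = ρ`, so the maximum
principle (7.3.1.8) alone makes `(u_ρ)` uniformly Cauchy off every `D_ρ` (replacing Lin's normal-family
and diagonal argument, Steps 2–3); the limit inherits `|u − Re (z − c)⁻¹| ≤ 8(r⁻¹ + R⁻¹)‖z − c‖/R` on
`0 < ‖z − c‖ ≤ R`, and §4 applies.

Written for the abc-iut cell's programme «UNIF-G1P» Tier 2 (GAP G-L4t8g7-2, brick P6 «parabolic case»);
classical mathematics, nothing here bears on [IUTchIII] Cor. 3.12.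

## References
* [Lin2011ClassicalComplexAnalysisII] I-Hsiung Lin, *Classical Complex Analysis: A Geometric Approach*,
  vol. 2 (2011), §7.3.3 (7.3.3.3) and its proof, Steps 1 and 3; Lemma (7.3.3.4).
* [FarkasKra1992] H. M. Farkas, I. Kra, *Riemann Surfaces*, 2nd ed. (1992), IV.3 (pp. 172–178).
-/

noncomputable section

open scoped Topology

namespace Literature.Analysis.Complex

open _root_.Complex Metric Set Filter Real InnerProductSpace

variable {c : ℂ} {R : ℝ}

/-! ### §1 Circle means on an annulus: holomorphy makes them constant (zero flux) -/

/-- **Cauchy's theorem on an annulus, mean form**: for `F` holomorphic on the open annulus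
`ρ < ‖z − c‖ < R` the circle means `⨍_{‖z−c‖=t} F` do not depend on `t ∈ (ρ, R)` (Mathlib's
Cauchy–Goursat for annuli, `∮ (z−c)⁻¹ F dz` form) — the case `n = 0` of Lin's (*8), whose right-hand side
is the same for every `ρ < t ≤ 1`. [cite: Lin2011ClassicalComplexAnalysisII, §7.3.3 (7.3.3.3) proof, Step 1 (*6)–(*8)]
[folklore] -/
theorem circleAverage_eq_of_differentiableOn_annulus {F : ℂ → ℂ} {ρ t₁ t₂ : ℝ} (hρ : 0 ≤ ρ)
    (hF : DifferentiableOn ℂ F (ball c R \ closedBall c ρ)) (h1 : ρ < t₁) (h12 : t₁ ≤ t₂) (h2 : t₂ < R) :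
    circleAverage F c t₂ = circleAverage F c t₁ := by
  have ht1 : 0 < t₁ := lt_of_le_of_lt hρ h1
  have ht2 : 0 < t₂ := ht1.trans_le h12
  have hU : IsOpen (ball c R \ closedBall c ρ) := isOpen_ball.sdiff isClosed_closedBall
  have hsub : closedBall c t₂ \ ball c t₁ ⊆ ball c R \ closedBall c ρ := by
    intro z hz
    simp only [Set.mem_sdiff, mem_closedBall, mem_ball, not_lt] at hz ⊢
    exact ⟨lt_of_le_of_lt hz.1 h2, fun h => (lt_irrefl ρ) (lt_of_lt_of_le (lt_of_lt_of_le h1 hz.2) h)⟩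
  have hc : ContinuousOn F (closedBall c t₂ \ ball c t₁) := hF.continuousOn.mono hsub
  have hd : ∀ z ∈ (ball c t₂ \ closedBall c t₁) \ (∅ : Set ℂ), DifferentiableAt ℂ F z := fun z hz =>
    hF.differentiableAt (hU.mem_nhds
      (hsub ⟨ball_subset_closedBall hz.1.1, fun h => hz.1.2 (ball_subset_closedBall h)⟩))
  have key := Complex.circleIntegral_sub_center_inv_smul_eq_of_differentiable_on_annulus_off_countable
    ht1 h12 countable_empty hc hd
  rw [circleAverage_eq_circleIntegral ht2.ne', circleAverage_eq_circleIntegral ht1.ne', key]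

/-- The real part commutes with circle means of a function continuous on the circle. [folklore] -/
private theorem circleAverage_re_eq_re_circleAverage {F : ℂ → ℂ} {t : ℝ} (hF : ContinuousOn F (sphere c |t|)) :
    circleAverage (fun z => (F z).re) c t = (circleAverage F c t).re := by
  have h := ContinuousLinearMap.circleAverage_comp_comm reCLM hF.circleIntegrable'
  rw [reCLM_apply] at h
  rw [← h]
  rfl

/-- **Circle means of `Re F` are constant on an annulus of holomorphy** (`t ∈ (ρ, R)`).  For a harmonic `u`
on an annulus, `u = Re F` with `F` single-valued holomorphic says exactly that the conjugate differential
`*du` has zero period («zero flux», Lin (7.3.3.4)); in general `⨍_{‖z−c‖=t} u = a + b log t` with `2πb`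
the flux. [cite: Lin2011ClassicalComplexAnalysisII, §7.3.3 (7.3.3.3) proof, Step 1 (*6)–(*8)] [folklore] -/
theorem circleAverage_re_eq_of_differentiableOn_annulus {F : ℂ → ℂ} {ρ t₁ t₂ : ℝ} (hρ : 0 ≤ ρ)
    (hF : DifferentiableOn ℂ F (ball c R \ closedBall c ρ)) (h1 : ρ < t₁) (h12 : t₁ ≤ t₂) (h2 : t₂ < R) :
    circleAverage (fun z => (F z).re) c t₂ = circleAverage (fun z => (F z).re) c t₁ := by
  have hsph : ∀ t, ρ < t → t < R → ContinuousOn F (sphere c |t|) := by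
    intro t ht htR
    have ht0 : 0 < t := lt_of_le_of_lt hρ ht
    rw [abs_of_pos ht0]
    refine hF.continuousOn.mono fun z hz => ?_
    rw [mem_sphere] at hz
    simp only [Set.mem_sdiff, mem_ball, mem_closedBall, not_le, hz]
    exact ⟨htR, ht⟩
  rw [circleAverage_re_eq_re_circleAverage (hsph t₂ (lt_of_lt_of_le h1 h12) h2),
    circleAverage_re_eq_re_circleAverage (hsph t₁ h1 (lt_of_le_of_lt h12 h2)),
    circleAverage_eq_of_differentiableOn_annulus hρ hF h1 h12 h2]

/-- Left-endpoint companion of Mathlib's `ContinuousOn.eq_of_eqOn_Ioo`: a function continuous on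
`[r, R)` and constant on `(r, R)` takes that constant value at `r`. [folklore] -/
private theorem eq_of_eqOn_Ioo_left {f : ℝ → ℝ} {a r R' : ℝ} (h₁f : ContinuousOn f (Ico r R')) (hR : r < R')
    (h₂f : EqOn f (fun _ => a) (Ioo r R')) : f r = a := by
  have h : Tendsto f (𝓝[>] r) (𝓝 (f r)) := by
    have hcw := (h₁f r (left_mem_Ico.mpr hR)).tendsto
    refine hcw.mono_left (nhdsWithin_le_iff.2 ?_)
    exact mem_of_superset (Ioo_mem_nhdsGT hR) Ioo_subset_Ico_self
  apply tendsto_nhds_unique h (tendsto_const_nhds.congr' _)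
  exact Filter.eventuallyEq_of_mem (Ioo_mem_nhdsGT hR) fun _ hx => (h₂f hx).symm

/-- **The means on the two boundary circles agree.** If `w` is continuous on the closed annulus
`ρ ≤ ‖z − c‖ ≤ R` (`0 < ρ < R`) and equals `Re F` on the open annulus for some `F` holomorphic there, then
`⨍_{‖z−c‖=R} w = ⨍_{‖z−c‖=ρ} w` (constancy inside, `circleAverage_re_eq_of_differentiableOn_annulus`, and
continuity of `t ↦ ⨍_{‖z−c‖=t} w` on `[ρ, R]`, Mathlib's `ContinuousOn.circleAverage`) — Lin's (*8) taken
at `t = ρ` and `t = 1`, case `n = 0`. [cite: Lin2011ClassicalComplexAnalysisII, §7.3.3 (7.3.3.3) proof, Step 1 (*8)–(*10)]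
[folklore] -/
theorem circleAverage_eq_circleAverage_of_re_eq {w : ℂ → ℝ} {F : ℂ → ℂ} {ρ : ℝ} (hρ : 0 < ρ) (hρR : ρ < R)
    (hwc : ContinuousOn w (closedBall c R \ ball c ρ))
    (hF : DifferentiableOn ℂ F (ball c R \ closedBall c ρ))
    (hwF : EqOn w (fun z => (F z).re) (ball c R \ closedBall c ρ)) :
    circleAverage w c R = circleAverage w c ρ := by
  -- continuity of the means on `[ρ, R]`
  have hm : ContinuousOn (circleAverage w c) (Icc ρ R) := by
    refine ContinuousOn.circleAverage (hwc.mono fun z hz => ?_) fun r hr => hρ.le.trans hr.1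
    simp only [mem_setOf_eq, mem_Icc] at hz
    simp only [Set.mem_sdiff, mem_closedBall, mem_ball, not_lt, dist_eq_norm]
    exact ⟨hz.2, hz.1⟩
  -- inside, the means are those of `Re F`, hence constant
  set t₀ : ℝ := (ρ + R) / 2 with ht₀
  have ht₀ρ : ρ < t₀ := by rw [ht₀]; linarith
  have ht₀R : t₀ < R := by rw [ht₀]; linarith
  have hinside : ∀ t ∈ Ioo ρ R, circleAverage w c t = circleAverage (fun z => (F z).re) c t := by
    intro t ht
    apply circleAverage_congr_sphere
    intro z hz
    rw [abs_of_pos (hρ.trans ht.1), mem_sphere] at hz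
    apply hwF
    simp only [Set.mem_sdiff, mem_ball, mem_closedBall, not_le, hz]
    exact ⟨ht.2, ht.1⟩
  have hconst : EqOn (circleAverage w c) (fun _ => circleAverage w c t₀) (Ioo ρ R) := by
    intro t ht
    show circleAverage w c t = circleAverage w c t₀
    rw [hinside t ht, hinside t₀ ⟨ht₀ρ, ht₀R⟩]
    rcases le_total t t₀ with h | h
    · exact (circleAverage_re_eq_of_differentiableOn_annulus hρ.le hF ht.1 h ht₀R).symm
    · exact circleAverage_re_eq_of_differentiableOn_annulus hρ.le hF ht₀ρ h ht.2
  have hRval : circleAverage w c R = circleAverage w c t₀ :=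
    ContinuousOn.eq_of_eqOn_Ioo (hm.mono Ioc_subset_Icc_self) hρR hconst
  have hρval : circleAverage w c ρ = circleAverage w c t₀ :=
    eq_of_eqOn_Ioo_left (hm.mono Ico_subset_Icc_self) hρR hconst
  rw [hRval, hρval]

/-- **Zero mean on the outer circle from vanishing on the inner one**: under the hypotheses of
`circleAverage_eq_circleAverage_of_re_eq`, if `w = 0` on `‖z − c‖ = ρ` then `⨍_{‖z−c‖=R} w = 0` — the
zero-mean hypothesis of `abs_le_mul_norm_of_harmonicOnNhd_annulus`; Lin's (*9), `α₀(ρ) = 0`.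
[cite: Lin2011ClassicalComplexAnalysisII, §7.3.3 (7.3.3.3) proof, Step 1 (*9)] [folklore] -/
theorem circleAverage_eq_zero_of_re_eq {w : ℂ → ℝ} {F : ℂ → ℂ} {ρ : ℝ} (hρ : 0 < ρ) (hρR : ρ < R)
    (hwc : ContinuousOn w (closedBall c R \ ball c ρ))
    (hF : DifferentiableOn ℂ F (ball c R \ closedBall c ρ))
    (hwF : EqOn w (fun z => (F z).re) (ball c R \ closedBall c ρ)) (h0 : ∀ z ∈ sphere c ρ, w z = 0) :
    circleAverage w c R = 0 := by
  rw [circleAverage_eq_circleAverage_of_re_eq hρ hρR hwc hF hwF]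
  have : circleAverage w c ρ = circleAverage (fun _ => (0 : ℝ)) c ρ :=
    circleAverage_congr_sphere fun z hz => by rw [abs_of_pos hρ] at hz; exact h0 z hz
  rw [this, circleAverage_const]

/-! ### §2 The dipole datum `Re (z − c)⁻¹` (Lin (7.3.3.3), Step 1, (*5)/(*12) with explicit constants) -/

/-- `Re (z − c)⁻¹` is harmonic off `c`. [folklore] -/
private theorem harmonicOnNhd_re_inv_sub (c : ℂ) : HarmonicOnNhd (fun z : ℂ => ((z - c)⁻¹).re) {c}ᶜ := by
  intro z hz
  have han : AnalyticAt ℂ (fun z : ℂ => (z - c)⁻¹) z :=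
    (analyticAt_id.sub analyticAt_const).inv (sub_ne_zero.2 hz)
  exact han.harmonicAt_re

/-- `|Re (z − c)⁻¹| ≤ ‖z − c‖⁻¹`. [folklore] -/
private theorem abs_re_inv_sub_le (z c : ℂ) : |((z - c)⁻¹).re| ≤ ‖z - c‖⁻¹ := by
  rw [← norm_inv]; exact Complex.abs_re_le_norm _

/-- **The dipole datum has zero mean on every circle about the pole**: `⨍_{‖z−c‖=t} Re (z − c)⁻¹ = 0`
(`∮ (z − c)⁻² dz = 0`; in Lin's (*7) the datum `Re 1/z = t⁻¹ cos θ` carries no constant Fourier term).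
[cite: Lin2011ClassicalComplexAnalysisII, §7.3.3 (7.3.3.3) proof, Step 1 (*7)] [folklore] -/
theorem circleAverage_re_inv_sub (c : ℂ) {t : ℝ} (ht : t ≠ 0) :
    circleAverage (fun z : ℂ => ((z - c)⁻¹).re) c t = 0 := by
  have hcont : ContinuousOn (fun z : ℂ => (z - c)⁻¹) (sphere c |t|) := by
    refine ContinuousOn.inv₀ (continuousOn_id.sub continuousOn_const) fun z hz => ?_
    rw [mem_sphere, dist_eq_norm] at hz
    rw [sub_ne_zero]; intro h; rw [h, sub_self, norm_zero] at hz
    exact ht (abs_eq_zero.1 hz.symm)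
  rw [circleAverage_re_eq_re_circleAverage hcont, circleAverage_eq_circleIntegral ht]
  have hfun : (fun z : ℂ => (z - c)⁻¹ • (z - c)⁻¹) = fun z => (z - c) ^ (-2 : ℤ) := by
    funext z
    rw [smul_eq_mul, ← pow_two, zpow_neg, zpow_ofNat, inv_pow]
  have hint : (∮ z in C(c, t), (z - c)⁻¹ • (z - c)⁻¹) = 0 := by
    rw [hfun]
    exact circleIntegral.integral_sub_zpow_of_ne (by norm_num) c c t
  rw [hint, smul_zero, Complex.zero_re]

/-- **Lin (7.3.3.3) Step 1, the uniform estimate (*5)/(*12), series-free.** Let `u` be continuous on the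
closed annulus `ρ ≤ ‖z − c‖ ≤ R` (`0 < ρ < R`), harmonic inside, with the dipole boundary values
`u = Re (z − c)⁻¹` on the inner circle, `|u| ≤ M` on the outer circle and zero mean there (zero flux). Then
`|u(z) − Re (z − c)⁻¹| ≤ 4(M + R⁻¹)‖z − c‖/R` on the closed annulus — uniformly in `ρ`.
[cite: Lin2011ClassicalComplexAnalysisII, §7.3.3 (7.3.3.3) proof, Step 1 (*5)–(*12)] [folklore] -/
theorem abs_sub_re_inv_le_of_harmonicOnNhd_annulus {u : ℂ → ℝ} {ρ M : ℝ} (hρ : 0 < ρ) (hρR : ρ < R)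
    (hu : HarmonicOnNhd u (ball c R \ closedBall c ρ)) (huc : ContinuousOn u (closedBall c R \ ball c ρ))
    (hbd : ∀ z ∈ sphere c ρ, u z = ((z - c)⁻¹).re) (hM : ∀ z ∈ sphere c R, |u z| ≤ M)
    (havg : circleAverage u c R = 0) :
    ∀ z ∈ closedBall c R \ ball c ρ, |u z - ((z - c)⁻¹).re| ≤ 4 * (M + R⁻¹) * ‖z - c‖ / R := by
  have hR : 0 < R := hρ.trans hρR
  have hAc : closedBall c R \ ball c ρ ⊆ ({c}ᶜ : Set ℂ) := by
    intro z hz hzc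
    rw [mem_singleton_iff] at hzc; subst hzc
    exact hz.2 (mem_ball_self hρ)
  have hUc : ball c R \ closedBall c ρ ⊆ ({c}ᶜ : Set ℂ) := fun z hz =>
    hAc ⟨ball_subset_closedBall hz.1, fun h => hz.2 (ball_subset_closedBall h)⟩
  have hd := harmonicOnNhd_re_inv_sub c
  have hw : HarmonicOnNhd (fun z => u z - ((z - c)⁻¹).re) (ball c R \ closedBall c ρ) :=
    hu.sub (hd.mono hUc)
  have hwc : ContinuousOn (fun z => u z - ((z - c)⁻¹).re) (closedBall c R \ ball c ρ) :=
    huc.sub (hd.continuousOn.mono hAc)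
  have h0 : ∀ z ∈ sphere c ρ, u z - ((z - c)⁻¹).re = 0 := fun z hz => by rw [hbd z hz, sub_self]
  have hK : ∀ z ∈ sphere c R, |u z - ((z - c)⁻¹).re| ≤ M + R⁻¹ := by
    intro z hz
    have hzR : ‖z - c‖ = R := by rwa [mem_sphere, dist_eq_norm] at hz
    calc |u z - ((z - c)⁻¹).re| ≤ |u z| + |((z - c)⁻¹).re| := abs_sub _ _
      _ ≤ M + R⁻¹ := add_le_add (hM z hz) ((abs_re_inv_sub_le z c).trans (by rw [hzR]))
  have hSA : sphere c R ⊆ closedBall c R \ ball c ρ := fun z hz =>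
    ⟨sphere_subset_closedBall hz, fun h => by
      rw [mem_ball] at h; rw [mem_sphere] at hz; rw [hz] at h; exact (lt_irrefl _) (h.trans hρR)⟩
  have havg' : circleAverage (fun z => u z - ((z - c)⁻¹).re) c R = 0 := by
    rw [circleAverage_fun_sub ((huc.mono hSA).circleIntegrable hR.le)
      ((hd.continuousOn.mono (hSA.trans hAc)).circleIntegrable hR.le), havg,
      circleAverage_re_inv_sub c hR.ne', sub_zero]
  exact abs_le_mul_norm_of_harmonicOnNhd_annulus hρ hρR hw hwc h0 hK havg'

/-- **The same estimate with zero flux supplied as a single-valued conjugate** (Lin's `f_ρ` of (*6)):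
if `u = Re F` on the open annulus for some `F` holomorphic there, the zero-mean hypothesis of
`abs_sub_re_inv_le_of_harmonicOnNhd_annulus` holds automatically (`⨍_{‖z−c‖=R} u = ⨍_{‖z−c‖=ρ} u =
⨍ Re (z − c)⁻¹ = 0`). [cite: Lin2011ClassicalComplexAnalysisII, §7.3.3 (7.3.3.3) proof, Step 1 (*6)]
[folklore] -/
theorem abs_sub_re_inv_le_of_re_eq {u : ℂ → ℝ} {F : ℂ → ℂ} {ρ M : ℝ} (hρ : 0 < ρ) (hρR : ρ < R)
    (huc : ContinuousOn u (closedBall c R \ ball c ρ))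
    (hF : DifferentiableOn ℂ F (ball c R \ closedBall c ρ)) (huF : EqOn u (fun z => (F z).re) (ball c R \ closedBall c ρ))
    (hbd : ∀ z ∈ sphere c ρ, u z = ((z - c)⁻¹).re) (hM : ∀ z ∈ sphere c R, |u z| ≤ M) :
    ∀ z ∈ closedBall c R \ ball c ρ, |u z - ((z - c)⁻¹).re| ≤ 4 * (M + R⁻¹) * ‖z - c‖ / R := by
  have hU : IsOpen (ball c R \ closedBall c ρ) := isOpen_ball.sdiff isClosed_closedBall
  have hu : HarmonicOnNhd u (ball c R \ closedBall c ρ) := by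
    intro z hz
    have han : AnalyticAt ℂ F z := hF.analyticAt (hU.mem_nhds hz)
    have hev : u =ᶠ[𝓝 z] fun z => (F z).re := Filter.eventuallyEq_of_mem (hU.mem_nhds hz) huF
    rw [harmonicAt_congr_nhds hev]
    exact han.harmonicAt_re
  have havg : circleAverage u c R = 0 := by
    rw [circleAverage_eq_circleAverage_of_re_eq hρ hρR huc hF huF]
    have : circleAverage u c ρ = circleAverage (fun z : ℂ => ((z - c)⁻¹).re) c ρ :=
      circleAverage_congr_sphere fun z hz => by rw [abs_of_pos hρ] at hz; exact hbd z hz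
    rw [this, circleAverage_re_inv_sub c hρ.ne']
  exact abs_sub_re_inv_le_of_harmonicOnNhd_annulus hρ hρR hu huc hbd hM havg

/-! ### §3 The bootstrap for `M(ρ) = max_{‖z−c‖=R} |u_ρ|` (Lin's constant `C(r)`) -/

/-- **Bootstrap arithmetic.** If `M ≤ r⁻¹ + 4(M + R⁻¹)·r/R` with `0 < r`, `8r ≤ R`, then `M ≤ 2r⁻¹ + R⁻¹`.
(On the surface: `M = max_{‖z‖=R} |u_ρ| ≤ max_{‖z‖=r} |u_ρ|` by the maximum principle on `R − D̄_r`,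
and the right-hand side is bounded through `abs_sub_re_inv_le_of_harmonicOnNhd_annulus`.)
[cite: Lin2011ClassicalComplexAnalysisII, §7.3.3 (7.3.3.3) proof, Step 1, «M(ρ) ≤ …, and hence»] [folklore] -/
theorem dipole_bootstrap {M r R' : ℝ} (hr : 0 < r) (hrR : 8 * r ≤ R')
    (h : M ≤ r⁻¹ + 4 * (M + R'⁻¹) * r / R') : M ≤ 2 * r⁻¹ + R'⁻¹ := by
  have hR : 0 < R' := by linarith
  have hRi : 0 < R'⁻¹ := inv_pos.2 hR
  have hri : 0 < r⁻¹ := inv_pos.2 hr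
  have hq : 4 * r / R' ≤ 1 / 2 := by
    rw [div_le_iff₀ hR]; linarith
  have hq0 : 0 ≤ 4 * r / R' := by positivity
  have hsplit : 4 * (M + R'⁻¹) * r / R' = 4 * r / R' * M + 4 * r / R' * R'⁻¹ := by ring
  rw [hsplit] at h
  by_cases hM : 0 ≤ M
  · have h1 : 4 * r / R' * M ≤ 1 / 2 * M := mul_le_mul_of_nonneg_right hq hM
    have h2 : 4 * r / R' * R'⁻¹ ≤ 1 / 2 * R'⁻¹ := mul_le_mul_of_nonneg_right hq hRi.le
    linarith
  · linarith

/-- **Uniform dipole estimate** (Lin's (*5) with `C(r)` explicit): if, in the situation of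
`abs_sub_re_inv_le_of_harmonicOnNhd_annulus`, the bound `M` for `|u|` on the outer circle is attained or
exceeded by `|u|` somewhere on the circle `‖z − c‖ = r`, `ρ ≤ r ≤ R/8` (which is what the maximum principle
on `R − D̄_r` provides for `M := max_{‖z−c‖=r} |u_ρ|`), then `|u(z) − Re (z − c)⁻¹| ≤ 8(r⁻¹ + R⁻¹)‖z − c‖/R`
on the closed annulus, a bound free of `ρ` and `M`.
[cite: Lin2011ClassicalComplexAnalysisII, §7.3.3 (7.3.3.3) proof, Step 1 (*5)] [folklore] -/
theorem abs_sub_re_inv_le_uniform {u : ℂ → ℝ} {ρ r M : ℝ} (hρ : 0 < ρ) (hρr : ρ ≤ r) (hrR : 8 * r ≤ R)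
    (hu : HarmonicOnNhd u (ball c R \ closedBall c ρ)) (huc : ContinuousOn u (closedBall c R \ ball c ρ))
    (hbd : ∀ z ∈ sphere c ρ, u z = ((z - c)⁻¹).re) (hM : ∀ z ∈ sphere c R, |u z| ≤ M)
    (havg : circleAverage u c R = 0) (hMr : ∃ z ∈ sphere c r, M ≤ |u z|) :
    ∀ z ∈ closedBall c R \ ball c ρ, |u z - ((z - c)⁻¹).re| ≤ 8 * (r⁻¹ + R⁻¹) * ‖z - c‖ / R := by
  have hr : 0 < r := hρ.trans_le hρr
  have hρR : ρ < R := by linarith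
  have hR : 0 < R := hρ.trans hρR
  have hest := abs_sub_re_inv_le_of_harmonicOnNhd_annulus hρ hρR hu huc hbd hM havg
  -- the bootstrap inequality at a point of the small circle
  obtain ⟨z₀, hz₀, hMz₀⟩ := hMr
  have hz₀n : ‖z₀ - c‖ = r := by rwa [mem_sphere, dist_eq_norm] at hz₀
  have hz₀A : z₀ ∈ closedBall c R \ ball c ρ := by
    simp only [Set.mem_sdiff, mem_closedBall, mem_ball, not_lt, dist_eq_norm, hz₀n]
    exact ⟨by linarith, hρr⟩
  have hboot : M ≤ r⁻¹ + 4 * (M + R⁻¹) * r / R := by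
    have h1 := hest z₀ hz₀A
    rw [hz₀n] at h1
    have h2 : |u z₀| ≤ |((z₀ - c)⁻¹).re| + |u z₀ - ((z₀ - c)⁻¹).re| := by
      have := abs_add_le (((z₀ - c)⁻¹).re) (u z₀ - ((z₀ - c)⁻¹).re)
      rwa [add_sub_cancel] at this
    have h3 : |((z₀ - c)⁻¹).re| ≤ r⁻¹ := (abs_re_inv_sub_le z₀ c).trans (by rw [hz₀n])
    linarith
  have hMle : M ≤ 2 * r⁻¹ + R⁻¹ := dipole_bootstrap hr hrR hboot
  have hcoef : 4 * (M + R⁻¹) ≤ 8 * (r⁻¹ + R⁻¹) := by linarith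
  intro z hz
  refine (hest z hz).trans ?_
  have hzc : 0 ≤ ‖z - c‖ := norm_nonneg _
  rw [div_le_div_iff_of_pos_right hR]
  exact mul_le_mul_of_nonneg_right hcoef hzc

/-! ### §4 Removability at the pole (Lin (7.3.3.3) (2)(b), Step 3) -/

/-- **Removable singularity of `u − Re (z − c)⁻¹` from a linear bound.** If `u` is harmonic on the punctured
disc `0 < ‖z − c‖ < R` and `|u(z) − Re (z − c)⁻¹| ≤ C‖z − c‖` there, then `u − Re (z − c)⁻¹` agrees on the
punctured disc with a function `h` harmonic on the whole disc with `h(c) = 0` (the tree's removable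
singularity theorem for bounded harmonic functions, then continuity at `c`).
[cite: Lin2011ClassicalComplexAnalysisII, §7.3.3 (7.3.3.3) (2)(b), proof Step 3] [folklore] -/
theorem exists_harmonicOnNhd_eq_sub_re_inv {u : ℂ → ℝ} {C : ℝ} (hR : 0 < R)
    (hu : HarmonicOnNhd u (ball c R \ {c}))
    (hC : ∀ z ∈ ball c R \ {c}, |u z - ((z - c)⁻¹).re| ≤ C * ‖z - c‖) :
    ∃ h : ℂ → ℝ, HarmonicOnNhd h (ball c R) ∧ h c = 0 ∧
      EqOn h (fun z => u z - ((z - c)⁻¹).re) (ball c R \ {c}) := by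
  set w : ℂ → ℝ := fun z => u z - ((z - c)⁻¹).re with hw_def
  have hPc : ball c R \ {c} ⊆ ({c}ᶜ : Set ℂ) := fun z hz => hz.2
  have hw : HarmonicOnNhd w (ball c R \ {c}) := hu.sub ((harmonicOnNhd_re_inv_sub c).mono hPc)
  have hwb : ∀ z ∈ ball c R \ {c}, |w z| ≤ C * R := by
    intro z hz
    have hzpos : 0 < ‖z - c‖ := norm_pos_iff.2 (sub_ne_zero.2 hz.2)
    have hzR : ‖z - c‖ < R := by rw [← dist_eq_norm]; exact mem_ball.1 hz.1
    have h1 := hC z hz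
    have hC0 : 0 ≤ C := by
      by_contra hneg
      push Not at hneg
      have : C * ‖z - c‖ < 0 := mul_neg_of_neg_of_pos hneg hzpos
      linarith [abs_nonneg (w z)]
    exact h1.trans (mul_le_mul_of_nonneg_left hzR.le hC0)
  obtain ⟨h, hh, hhw⟩ := exists_harmonicOnNhd_ball_eqOn_of_bounded hR (fun z hz => hw z hz) hwb
  refine ⟨h, hh, ?_, hhw⟩
  -- `h c = 0`: `h` is continuous at `c` and `|h z| ≤ C‖z − c‖` on the punctured disc
  have hcont : ContinuousAt h c := (hh c (mem_ball_self hR)).1.continuousAt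
  have hlim1 : Tendsto h (𝓝[≠] c) (𝓝 (h c)) := hcont.tendsto.mono_left nhdsWithin_le_nhds
  have hlim2 : Tendsto h (𝓝[≠] c) (𝓝 0) := by
    have hbound : Tendsto (fun z : ℂ => C * ‖z - c‖) (𝓝[≠] c) (𝓝 0) := by
      have : Tendsto (fun z : ℂ => C * ‖z - c‖) (𝓝 c) (𝓝 (C * ‖c - c‖)) :=
        (continuous_const.mul (continuous_id.sub continuous_const).norm).continuousAt.tendsto
      rw [sub_self, norm_zero, mul_zero] at this
      exact this.mono_left nhdsWithin_le_nhds
    have hev : ∀ᶠ z in 𝓝[≠] c, ‖h z‖ ≤ C * ‖z - c‖ := by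
      filter_upwards [sdiff_mem_nhdsWithin_compl (isOpen_ball.mem_nhds (mem_ball_self hR)) {c}]
        with z hz
      rw [Real.norm_eq_abs, hhw hz]
      exact hC z hz
    exact squeeze_zero_norm' hev hbound
  exact tendsto_nhds_unique hlim1 hlim2

end Literature.Analysis.Complex

end
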